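import Literature.Combinatorics.Enumerative.RyserFormula
import Literature.Computability.AlgebraicComplexity.ArithCircuitProofs
import Summits.ValiantsHypothesis.ValiantsHypothesis.Theorems.TwoAdicLadderTwoIntegralNormalisationScaledHalfElim

/-!
# TwoAdicLadder — crux `TwoIntegralNormalisation` (stmt-ValiantsHypothesis-5947), line `birth`,
# stub `stub_halfElim`: RYSER'S `2ⁿ·poly(n)` CIRCUITS OVER EVERY RING, AND THE HARD-WORLD CALIBRATION

Route `ValiantsHypothesis/TwoAdicLadder`, crux `TwoIntegralNormalisation`, registered line
`Cruxes/TwoIntegralNormalisation/Lines/birth.lean`, open stub `stub_halfElim` (uniform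
`1/2`-elimination: `L_{𝓞_(𝔭)}(per_n) ≤ (L_K(per_n) + n + 2)^d`). Two calibration facts:

* `complexity_perPoly_le_two_pow_mul` — **Ryser's formula as a circuit: over every commutative ring
  `L(per_n) ≤ 2ⁿ · (n² + n + 2)`** (tree `Matrix.permanent_eq_ryser`: `per = Σ_S (−1)^{n−|S|}
  Π_i Σ_{j∈S} x_{ij}`, `2ⁿ` terms of cost `n² + n + 1` each). The route text quotes "general
  algebraic upper bound any ring: Ryser `2^n·n²`" without a tree declaration; here it is.
* `halfElim_of_expHard` — **in the exponentially-hard world the registered stub holds**: if one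
  exponent `c` gives `2ⁿ ≤ (s + n + 2)^c` whenever `L_K(per_n) ≤ s` over a number field (uniform
  exponential hardness of the permanent over number fields — a strong form of VP ≠ VNP), then
  `stub_halfElim` holds with `d = 2c + 1`, `K' = K`, any `𝔭 ∋ 2` (Ryser's `2`-integral circuits fit
  the envelope). Together with `halfElimGlobal_of_valiantsHypothesis` /
  `twoIntegralNormalisation_of_halfElim` (`…OfHalfElim.lean`) this brackets the registered stub:
  it holds if `per` is uniformly `2^{Ω(n)}`-hard over number fields and (trivially) if `per` has
  polynomial `2`-integral circuits; it can only fail in an intermediate world (e.g.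
  `L_ℚ̄(per_n) = n^{log n}` but `L_{ℤ_(2)}(per_n) = 2^{√n}`), where VP ≠ VNP still holds — so,
  unlike the crux, the registered stub is not implied by the summit.

Honest framing: calibration only; `stub_halfElim`, the crux and VP ≠ VNP are NOT proved here.
-/

noncomputable section

open MvPolynomial

-- the summit and the problem share the name `ValiantsHypothesis` (D-0017 single-conjunct layout)
set_option linter.dupNamespace false

namespace Summit.ValiantsHypothesis.ValiantsHypothesis.Theorems.TwoAdicLadder.TwoIntegralNormalisation

open NumberField Literature.Computability.AlgebraicComplexity

/-- **Ryser's formula as a circuit.** Over every commutative ring, the generic permanent has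
fan-in-two circuits of size `≤ 2ⁿ · (n² + n + 2)`: the `2ⁿ` products of row sums
`Π_i Σ_{j ∈ S} x_{ij}` cost `≤ n² + n` gates each, one scalar gate for the sign, and `2ⁿ` additions.
[cite: Ryser1963, Ch. 2 Cor. 4.2] -/
theorem complexity_perPoly_le_two_pow_mul (n : ℕ) (R : Type*) [CommRing R] :
    complexity (perPoly (Fin n) R) ≤ 2 ^ n * (n ^ 2 + n + 2) := by
  classical
  have hR := Literature.Combinatorics.Enumerative.permanent_eq_ryser
    (Matrix.mvPolynomialX (Fin n) (Fin n) R)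
  rw [perPoly, hR]
  -- cost of one term
  have hrow : ∀ (S : Finset (Fin n)) (i : Fin n),
      complexity (∑ j ∈ S, Matrix.mvPolynomialX (Fin n) (Fin n) R i j) ≤ n := by
    intro S i
    refine (complexity_finset_sum_le _ _).trans ?_
    have h0 : ∀ j ∈ S, complexity (Matrix.mvPolynomialX (Fin n) (Fin n) R i j) = 0 := fun j _ => by
      rw [Matrix.mvPolynomialX_apply]; exact complexity_X_holds _
    rw [Finset.sum_congr rfl h0, Finset.sum_const_zero, zero_add]
    exact (Finset.card_le_univ S).trans (by simp)
  have hprod : ∀ S : Finset (Fin n),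
      complexity (∏ i, ∑ j ∈ S, Matrix.mvPolynomialX (Fin n) (Fin n) R i j) ≤ n ^ 2 + n := by
    intro S
    refine (complexity_finset_prod_le _ _).trans ?_
    rw [Finset.card_univ, Fintype.card_fin]
    have : ∑ i : Fin n, complexity (∑ j ∈ S, Matrix.mvPolynomialX (Fin n) (Fin n) R i j) ≤ n * n :=
      (Finset.sum_le_card_nsmul _ _ _ fun i _ => hrow S i).trans (by simp)
    nlinarith
  have hterm : ∀ S : Finset (Fin n),
      complexity ((-1 : MvPolynomial (Fin n × Fin n) R) ^ (Fintype.card (Fin n) - S.card) *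
        ∏ i, ∑ j ∈ S, Matrix.mvPolynomialX (Fin n) (Fin n) R i j) ≤ n ^ 2 + n + 1 := by
    intro S
    refine (complexity_mul_le_holds _ _).trans ?_
    have hc : complexity ((-1 : MvPolynomial (Fin n × Fin n) R) ^ (Fintype.card (Fin n) - S.card)) = 0 := by
      rw [show (-1 : MvPolynomial (Fin n × Fin n) R) = C (-1) by simp, ← map_pow]
      exact complexity_C_holds _
    rw [hc, zero_add]
    exact Nat.add_le_add_right (hprod S) 1
  refine (complexity_finset_sum_le _ _).trans ?_
  rw [Finset.card_univ, Fintype.card_finset, Fintype.card_fin]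
  have hsum := Finset.sum_le_card_nsmul (Finset.univ : Finset (Finset (Fin n))) _ _
    fun S _ => hterm S
  rw [Finset.card_univ, Fintype.card_finset, Fintype.card_fin, smul_eq_mul] at hsum
  calc _ ≤ 2 ^ n * (n ^ 2 + n + 1) + 2 ^ n := Nat.add_le_add_right hsum _
    _ = 2 ^ n * (n ^ 2 + n + 2) := by ring

/-- `n² + n + 2 ≤ 2^(n+1)`. [folklore] -/
theorem sq_add_le_two_pow_succ (n : ℕ) : n ^ 2 + n + 2 ≤ 2 ^ (n + 1) := by
  induction n with
  | zero => norm_num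
  | succ m ih =>
    have h : (m + 1) ^ 2 + (m + 1) + 2 ≤ 2 * (m ^ 2 + m + 2) := by nlinarith
    calc (m + 1) ^ 2 + (m + 1) + 2 ≤ 2 * (m ^ 2 + m + 2) := h
      _ ≤ 2 * 2 ^ (m + 1) := Nat.mul_le_mul_left 2 ih
      _ = 2 ^ (m + 1 + 1) := by ring

/-- **The registered stub holds in the exponentially-hard world.** If one exponent `c` gives
`2ⁿ ≤ (s + n + 2)^c` whenever `L_K(per_n) ≤ s` for a number field `K` (uniform exponential
hardness of the permanent over number fields), then the registered signature of `stub_halfElim`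
holds with `d = 2c + 1`: Ryser's circuit over `𝓞_(𝔭)` has size `≤ 2ⁿ(n² + n + 2) ≤ 2^(2n+1) ≤
(s + n + 2)^(2c+1)`. [folklore] -/
theorem halfElim_of_expHard
    (h : ∃ c : ℕ, ∀ (n s : ℕ) (K : Type) [Field K] [NumberField K],
      complexity (perPoly (Fin n) K) ≤ s → 2 ^ n ≤ (s + n + 2) ^ c) :
    ∃ d : ℕ, ∀ (n s : ℕ) (K : Type) [Field K] [NumberField K],
      complexity (perPoly (Fin n) K) ≤ s →
        ∃ (K' : Type) (_ : Field K') (_ : NumberField K')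
          (P : Ideal (𝓞 K')) (_ : P.IsPrime),
          (2 : 𝓞 K') ∈ P ∧
          complexity (perPoly (Fin n) (Localization.AtPrime P)) ≤ (s + n + 2) ^ d := by
  obtain ⟨c, hc⟩ := h
  refine ⟨2 * c + 1, fun n s K hFK hNK hs => ?_⟩
  obtain ⟨P, hP, h2⟩ := exists_isPrime_two_mem K
  refine ⟨K, hFK, hNK, P, hP, h2, ?_⟩
  have h2n := @hc n s K hFK hNK hs
  have hB : 2 ≤ s + n + 2 := by omega
  calc complexity (perPoly (Fin n) (Localization.AtPrime P))
      ≤ 2 ^ n * (n ^ 2 + n + 2) := complexity_perPoly_le_two_pow_mul n _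
    _ ≤ 2 ^ n * 2 ^ (n + 1) := Nat.mul_le_mul_left _ (sq_add_le_two_pow_succ n)
    _ = 2 ^ n * 2 ^ n * 2 := by ring
    _ ≤ (s + n + 2) ^ c * (s + n + 2) ^ c * (s + n + 2) :=
        Nat.mul_le_mul (Nat.mul_le_mul h2n h2n) hB
    _ = (s + n + 2) ^ (2 * c + 1) := by ring

end Summit.ValiantsHypothesis.ValiantsHypothesis.Theorems.TwoAdicLadder.TwoIntegralNormalisation

end
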